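import Mathlib.FieldTheory.KummerExtension
import Mathlib.FieldTheory.Relrank
import HarnessLib

/-!
# X11b at `p = 3` (team N8/O2), S28-b: two conjugate radical subfields of a pure Kummer extension
# of prime-power degree intersect trivially — `K(x) ∩ K(ζx) = K` (the field-theory content of
# (K1′)/(K1″) of `cells/x11b3/S28-K1-CHECK.md`)

HONEST FRAMING (cell `b2b-bsdres`, run/shared/lean/b2b/bsd-rank1-residual/, verbatim in every
file): the goal of the cell is to DELETE the COMBINATION-SHAPED residual classes of the
Birch–Swinnerton-Dyer formula for ALL analytic-rank `≤ 1` elliptic curves over `ℚ` — "full BSD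
formula for every rank `≤ 1` curve in class `C`" assembled STRICTLY from published theorems — so
that the rank-`≤ 1` remainder becomes exactly the CONSTRUCTION-SHAPED classes, which are TYPED
(missing-input `Prop`s), NOT attempted. This is not "finishing BSD". Team N8/O2 = `x11b3`, seat
`b2b-bsdres-x11b3-p4` (lead GEN 7 R8-18: S28-b = (K1′) as a kernel theorem, GO-WHEN-FREE after
S28-0 = PASS, x11b3-r2 GEN 8, `cells/x11b3/S28-K1-CHECK.md` §4/§7 (c)). S28 is a READING of the
descent residual `Three.HsiehDescentAt₃` (H45: nothing shrinks; the node of record is unchanged).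
THEOREMS ONLY: no definition, no named fact, no `sorry`; nothing is booked; pure field theory, no
`p`-adic input (piece (P1) of the seat's scoping note `S28b-SCOPE.md`; the `unrIntegers 3` API is
piece (P2)).

## What

Let `K ⊆ Ω` be fields, `ℓ` an ODD prime, `a ∈ K` NOT an `ℓ`-th power in `K`, and suppose `K`
contains no primitive `ℓ`-th root of unity (`∀ z ∈ K, z^ℓ = 1 → z = 1`). Let `x ∈ Ω` with
`x^{ℓ^k} = a` and `ζ ∈ Ω` a primitive `ℓ^k`-th root of unity. Then

  **`adjoin_inf_adjoin_mul_eq_bot`**: `K⟮x⟯ ⊓ K⟮ζ * x⟯ = ⊥`.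

(At `ℓ = 3`, `K = 𝔎 :=` the completed maximal unramified extension of `ℚ₃` inside `Ω = ℂ₃`,
`a = x₀^{3^k}` PURE, this is (K1″): two members of the twist family already intersect in `𝔎`.)
Steps, following r2's (D1)–(D4):
* §1 `finrank_adjoin_eq_prime_pow` (D1): by Capelli (Mathlib `X_pow_sub_C_irreducible_of_prime_pow`,
  `ℓ ≠ 2`) `X^{ℓ^j} − a` is irreducible, so `[K(y) : K] = ℓ^j` whenever `y^{ℓ^j} = a`.
* §2 `eq_one_of_pow_eq_one_of_mem` (D2): an intermediate field `F` of `ℓ`-power degree contains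
  no `ℓ`-power root of unity `w ≠ 1` — a power `η` of `w` would be a PRIMITIVE `ℓ`-th root of unity
  in `F`, `[K(η) : K] ≤ ℓ − 1` (it is a root of `1 + X + ⋯ + X^{ℓ−1}`) and divides `ℓ^k`, hence
  `= 1`, i.e. `η ∈ K` — excluded. (No "`[K(ζ₃):K] = 2`" is needed.)
* §3 `exists_pow_mem_eq_adjoin_of_le` (D3, the subfield lemma — Acosta de Orozco–Vélez in this
  special case): every `E` between `K` and `K(x)` is `K(x^{ℓ^{k−j}})`, `ℓ^j = [E : K]`: the
  minimal polynomial of `x` over `E` divides `X^{ℓ^k} − a = ∏ (X − ζ^i x)` (Mathlib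
  `X_pow_sub_C_eq_prod`, which splits in `Ω` because `ζ, x ∈ Ω`), so its constant coefficient is
  `± ζ^s x^d` (`d = [K(x) : E]`) and lies in `E`; then `ζ^s ∈ K(x)`, so `ζ^s = 1` by §2, `x^d ∈ E`,
  and the degrees force `E = K(x^d)`.
* §4 the theorem (D4): `E := K(x) ∩ K(ζx)` is `K(x^d)` and `K((ζx)^d)` for the same `d`, so
  `ζ^d ∈ K(x)`, `ζ^d = 1`, `ℓ^k ∣ d`, `E = K`.

References (locators only; no new fact): [cite: Lang2002, VI §9 (Capelli's theorem)];
background for §3: M. Acosta de Orozco, W. Y. Vélez, *The lattice of subfields of a radical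
extension*, J. Number Theory 15 (1982) 388–405 (not cited as a fact: the special case needed is
proved here in full over Mathlib).

## Design

No definitions; `K`, `Ω` arbitrary fields with `[Algebra K Ω]`; Mathlib's `IntermediateField`,
`minpoly`, `relfinrank`. Not under `X11b/Three/`: nothing is `3`-specific. Axioms: `propext`,
`Classical.choice`, `Quot.sound`.
-/

open Polynomial IntermediateField Module

namespace Summit.BirchSwinnertonDyer.Rank1Residual.X11b.KummerRadical

variable {K : Type*} [Field K] {Ω : Type*} [Field Ω] [Algebra K Ω]

/-! ### §1 (D1) Degrees of the radical subfields -/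

/-- If `a ∈ K` is not an `ℓ`-th power then `a ≠ 0`. [folklore] -/
theorem ne_zero_of_forall_pow_ne {ℓ : ℕ} (hℓ : ℓ.Prime) {a : K} (ha : ∀ b : K, b ^ ℓ ≠ a) : a ≠ 0 :=
  fun h ↦ ha 0 (by rw [h, zero_pow hℓ.ne_zero])

/-- A root `y ∈ Ω` of `X^{ℓ^j} − a` is non-zero when `a` is not an `ℓ`-th power. [folklore] -/
theorem root_ne_zero {ℓ : ℕ} (hℓ : ℓ.Prime) {a : K} (ha : ∀ b : K, b ^ ℓ ≠ a) {j : ℕ} {y : Ω}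
    (hy : y ^ ℓ ^ j = algebraMap K Ω a) : y ≠ 0 := by
  intro h
  rw [h, zero_pow (pow_ne_zero _ hℓ.ne_zero), eq_comm, map_eq_zero] at hy
  exact ne_zero_of_forall_pow_ne hℓ ha hy

/-- **(D1) Capelli: `[K(y) : K] = ℓ^j` for `y^{ℓ^j} = a`, `a ∉ K^ℓ`, `ℓ` an odd prime** — the
polynomial `X^{ℓ^j} − a` is irreducible (Mathlib `X_pow_sub_C_irreducible_of_prime_pow`) and is
therefore the minimal polynomial of `y`. [cite: Lang2002, VI §9] -/
theorem finrank_adjoin_eq_prime_pow {ℓ : ℕ} (hℓ : ℓ.Prime) (hℓ2 : ℓ ≠ 2) {a : K}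
    (ha : ∀ b : K, b ^ ℓ ≠ a) (j : ℕ) {y : Ω} (hy : y ^ ℓ ^ j = algebraMap K Ω a) :
    finrank K K⟮y⟯ = ℓ ^ j := by
  have hirr : Irreducible (X ^ ℓ ^ j - C a : K[X]) :=
    X_pow_sub_C_irreducible_of_prime_pow hℓ hℓ2 j ha
  have hmonic : (X ^ ℓ ^ j - C a : K[X]).Monic := monic_X_pow_sub_C a (pow_ne_zero _ hℓ.ne_zero)
  have hroot : aeval y (X ^ ℓ ^ j - C a : K[X]) = 0 := by
    simp only [map_sub, map_pow, aeval_X, aeval_C, hy, sub_self]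
  have hint : IsIntegral K y := ⟨_, hmonic, by rwa [← aeval_def]⟩
  rw [adjoin.finrank hint, ← minpoly.eq_of_irreducible_of_monic hirr hroot hmonic,
    natDegree_X_pow_sub_C]

/-! ### §2 (D2) No non-trivial `ℓ`-power roots of unity in an extension of `ℓ`-power degree -/

/-- **(D2)** Let `F` be an intermediate field of `Ω/K` of degree `ℓ^k`, `K` containing no primitive
`ℓ`-th root of unity. Then every `w ∈ F` with `w^{ℓ^m} = 1` equals `1`: otherwise a suitable power
`η` of `w` is a primitive `ℓ`-th root of unity in `F`; `η` is a root of `1 + X + ⋯ + X^{ℓ−1}`, so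
`[K(η) : K] ≤ ℓ − 1`, while `[K(η) : K]` divides `[F : K] = ℓ^k` — hence `[K(η) : K] = 1`,
`η ∈ K`, contradiction. [folklore] -/
theorem eq_one_of_pow_eq_one_of_mem {ℓ : ℕ} (hℓ : ℓ.Prime) (hζK : ∀ z : K, z ^ ℓ = 1 → z = 1)
    {F : IntermediateField K Ω} {k : ℕ} (hF : finrank K F = ℓ ^ k) {w : Ω} (hw : w ∈ F) {m : ℕ}
    (hwm : w ^ ℓ ^ m = 1) : w = 1 := by
  classical
  by_contra hw1
  haveI : FiniteDimensional K F := Module.finite_of_finrank_pos (by rw [hF]; exact pow_pos hℓ.pos k)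
  -- the order of `w` is a positive power of `ℓ`
  have hord : orderOf w ∣ ℓ ^ m := orderOf_dvd_of_pow_eq_one hwm
  obtain ⟨i, hi, hiord⟩ := (Nat.dvd_prime_pow hℓ).mp hord
  have hi0 : i ≠ 0 := by
    rintro rfl
    rw [pow_zero, orderOf_eq_one_iff] at hiord
    exact hw1 hiord
  have hprim : IsPrimitiveRoot w (ℓ ^ i) := by
    rw [← hiord]; exact IsPrimitiveRoot.orderOf w
  -- a primitive `ℓ`-th root of unity in `F`
  set η : Ω := w ^ ℓ ^ (i - 1) with hη
  have hηprim : IsPrimitiveRoot η ℓ :=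
    hprim.pow (pow_pos hℓ.pos _) (by rw [← pow_succ, Nat.sub_add_cancel (Nat.one_le_iff_ne_zero.mpr hi0)])
  have hηF : η ∈ F := pow_mem hw _
  have hη1 : η ≠ 1 := hηprim.ne_one hℓ.one_lt
  -- `[K(η) : K] ≤ ℓ - 1`
  set P : K[X] := ∑ n ∈ Finset.range ℓ, X ^ n with hP
  have hPη : aeval η P = 0 := by
    rw [hP, map_sum]
    simp only [map_pow, aeval_X]
    exact hηprim.geom_sum_eq_zero hℓ.one_lt
  have hP0 : P ≠ 0 := by
    intro h
    have h1 := congrArg (fun Q : K[X] ↦ Q.coeff 0) h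
    simp only [hP, finsetSum_coeff, coeff_X_pow, coeff_zero] at h1
    rw [Finset.sum_eq_single 0 (fun b _ hb ↦ if_neg (Ne.symm hb)) (fun h0 ↦ absurd
      (Finset.mem_range.mpr hℓ.pos) h0)] at h1
    simp at h1
  have hPdeg : P.natDegree ≤ ℓ - 1 := by
    rw [hP]
    refine Polynomial.natDegree_sum_le_of_forall_le _ _ fun n hn ↦ ?_
    rw [natDegree_X_pow]
    have := Finset.mem_range.mp hn
    omega
  have hint : IsIntegral K η := IsIntegral.of_pow hℓ.pos (by
    rw [hηprim.pow_eq_one]; exact isIntegral_one)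
  have hdeg : finrank K K⟮η⟯ ≤ ℓ - 1 := by
    rw [adjoin.finrank hint]
    exact (natDegree_le_natDegree (minpoly.degree_le_of_ne_zero K η hP0 hPη)).trans hPdeg
  -- `[K(η) : K] ∣ ℓ ^ k`, hence `= 1`
  have hdvd : finrank K K⟮η⟯ ∣ ℓ ^ k := by
    rw [← hF]; exact finrank_dvd_of_le_right (adjoin_simple_le_iff.mpr hηF)
  obtain ⟨i', hi', hfin⟩ := (Nat.dvd_prime_pow hℓ).mp hdvd
  have hi'0 : i' = 0 := by
    by_contra hne
    have : ℓ ≤ finrank K K⟮η⟯ := by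
      rw [hfin]; exact Nat.le_self_pow hne ℓ
    have := hℓ.two_le
    omega
  rw [hi'0, pow_zero, IntermediateField.finrank_eq_one_iff] at hfin
  -- so `η ∈ K`, contradicting `hζK`
  have hηbot : η ∈ (⊥ : IntermediateField K Ω) := by
    rw [← hfin]; exact mem_adjoin_simple_self K η
  obtain ⟨z, hz⟩ := mem_bot.mp hηbot
  have hz1 : z ^ ℓ = 1 := by
    apply (algebraMap K Ω).injective
    rw [map_pow, hz, hηprim.pow_eq_one, map_one]
  exact hη1 (by rw [← hz, hζK z hz1, map_one])

/-! ### §3 (D3) The subfields of `K(x)/K` -/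

/-- The roots of a divisor of `X^n − a = ∏ (X − ζ^i x)` are of the form `ζ^i x`, so the product of
any multiset of them is `ζ^s x^{card}`. [folklore] -/
theorem exists_prod_eq_pow_mul_pow {ζ x : Ω} (T : Multiset Ω)
    (hT : ∀ r ∈ T, ∃ i, r = ζ ^ i * x) : ∃ s : ℕ, T.prod = ζ ^ s * x ^ Multiset.card T := by
  induction T using Multiset.induction_on with
  | empty => exact ⟨0, by simp⟩
  | cons r T ih =>
    obtain ⟨s, hs⟩ := ih fun r' hr' ↦ hT r' (Multiset.mem_cons_of_mem hr')
    obtain ⟨i, hi⟩ := hT r (Multiset.mem_cons_self r T)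
    refine ⟨i + s, ?_⟩
    rw [Multiset.prod_cons, hs, hi, Multiset.card_cons, pow_add, pow_succ]
    ring

/-- **(D3) The subfield lemma**: for `x^{ℓ^k} = a` (`a ∉ K^ℓ`, `ℓ` odd prime, no primitive `ℓ`-th
root of unity in `K`) and `ζ` a primitive `ℓ^k`-th root of unity in `Ω`, every intermediate field
`E ⊆ K(x)` is `K(x^{ℓ^{k−j}})` with `ℓ^j = [E : K]`: the minimal polynomial of `x` over `E` divides
`X^{ℓ^k} − a = ∏_{i} (X − ζ^i x)`, so its constant coefficient `± ζ^s x^d ∈ E` (`d = [K(x) : E]`);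
hence `ζ^s ∈ K(x)`, `ζ^s = 1` by (D2), `x^d ∈ E`, and `[K(x^d) : K] = [E : K]` gives equality.
[folklore] -/
theorem exists_pow_mem_eq_adjoin_of_le {ℓ : ℕ} (hℓ : ℓ.Prime) (hℓ2 : ℓ ≠ 2) {a : K}
    (ha : ∀ b : K, b ^ ℓ ≠ a) (hζK : ∀ z : K, z ^ ℓ = 1 → z = 1) {k : ℕ} {x ζ : Ω}
    (hx : x ^ ℓ ^ k = algebraMap K Ω a) (hζ : IsPrimitiveRoot ζ (ℓ ^ k))
    {E : IntermediateField K Ω} (hE : E ≤ K⟮x⟯) :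
    ∃ j ≤ k, x ^ ℓ ^ (k - j) ∈ E ∧ E = K⟮x ^ ℓ ^ (k - j)⟯ ∧ finrank K E = ℓ ^ j := by
  classical
  have hn : 0 < ℓ ^ k := pow_pos hℓ.pos k
  have hx0 : x ≠ 0 := root_ne_zero hℓ ha hx
  have hKx : finrank K K⟮x⟯ = ℓ ^ k := finrank_adjoin_eq_prime_pow hℓ hℓ2 ha k hx
  haveI : FiniteDimensional K K⟮x⟯ := Module.finite_of_finrank_pos (by rw [hKx]; exact hn)
  -- `[E : K] = ℓ^j`, `[K(x) : E] = ℓ^(k-j) =: d`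
  have hdvd : finrank K E ∣ ℓ ^ k := by rw [← hKx]; exact finrank_dvd_of_le_right hE
  obtain ⟨j, hj, hEj⟩ := (Nat.dvd_prime_pow hℓ).mp hdvd
  haveI : FiniteDimensional K E := Module.finite_of_finrank_pos (by rw [hEj]; exact pow_pos hℓ.pos j)
  set d : ℕ := ℓ ^ (k - j) with hd
  have hrel : relfinrank E K⟮x⟯ = d := by
    have h := finrank_bot_mul_relfinrank hE
    rw [hEj, hKx, ← pow_mul_pow_sub ℓ hj] at h
    exact mul_left_cancel₀ (pow_ne_zero j hℓ.ne_zero) h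
  -- the minimal polynomial of `x` over `E` has degree `d`
  have hintK : IsIntegral K x := ⟨_, monic_X_pow_sub_C a hn.ne', by
    rw [← aeval_def]; simp only [map_sub, map_pow, aeval_X, aeval_C, hx, sub_self]⟩
  have hintE : IsIntegral E x := hintK.tower_top
  have hdeg : (minpoly E x).natDegree = d := by
    rw [← adjoin.finrank hintE, ← extendScalars_adjoin hE, ← relfinrank_eq_finrank_of_le hE, hrel]
  -- it divides `X^(ℓ^k) - a = ∏ (X - ζ^i x)` in `Ω[X]`
  set mΩ : Ω[X] := (minpoly E x).map (algebraMap E Ω) with hmΩ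
  have hmonic : mΩ.Monic := (minpoly.monic hintE).map _
  have hP : (X ^ ℓ ^ k - C (algebraMap K Ω a) : Ω[X]) =
      ∏ i ∈ Finset.range (ℓ ^ k), (X - C (ζ ^ i * x)) := X_pow_sub_C_eq_prod hζ hn hx
  have hdvdP : mΩ ∣ X ^ ℓ ^ k - C (algebraMap K Ω a) := by
    have h1 : minpoly E x ∣ (X ^ ℓ ^ k - C a : K[X]).map (algebraMap K E) := by
      apply minpoly.dvd
      rw [aeval_map_algebraMap]
      simp only [map_sub, map_pow, aeval_X, aeval_C, hx, sub_self]
    have h2 := Polynomial.map_dvd (algebraMap E Ω) h1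
    rw [Polynomial.map_map, ← IsScalarTower.algebraMap_eq] at h2
    simpa only [Polynomial.map_sub, Polynomial.map_pow, map_X, map_C] using h2
  have hP0 : (X ^ ℓ ^ k - C (algebraMap K Ω a) : Ω[X]) ≠ 0 :=
    (monic_X_pow_sub_C _ hn.ne').ne_zero
  have hPsplit : (X ^ ℓ ^ k - C (algebraMap K Ω a) : Ω[X]).Splits :=
    X_pow_sub_C_splits_of_isPrimitiveRoot hζ hx
  have hsplit : mΩ.Splits := hPsplit.of_dvd hP0 hdvdP
  -- its roots are of the form `ζ^i x`
  have hroots : ∀ r ∈ mΩ.roots, ∃ i, r = ζ ^ i * x := by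
    intro r hr
    have hr' : (X ^ ℓ ^ k - C (algebraMap K Ω a) : Ω[X]).IsRoot r :=
      (mem_roots hmonic.ne_zero).mp hr |>.dvd hdvdP
    rw [hP, IsRoot, eval_prod, Finset.prod_eq_zero_iff] at hr'
    obtain ⟨i, -, hi⟩ := hr'
    rw [eval_sub, eval_X, eval_C, sub_eq_zero] at hi
    exact ⟨i, hi⟩
  obtain ⟨s, hs⟩ := exists_prod_eq_pow_mul_pow mΩ.roots hroots
  have hcard : Multiset.card mΩ.roots = d := by
    rw [← hsplit.natDegree_eq_card_roots, hmΩ, (minpoly.monic hintE).natDegree_map, hdeg]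
  rw [hcard] at hs
  -- the constant coefficient `(-1)^d ζ^s x^d` lies in `E`
  have hcoeff : mΩ.coeff 0 = (-1) ^ d * (ζ ^ s * x ^ d) := by
    rw [hsplit.coeff_zero_eq_prod_roots_of_monic hmonic, hs, hmΩ, (minpoly.monic hintE).natDegree_map,
      hdeg]
  have hmemE : ζ ^ s * x ^ d ∈ E := by
    have h1 : mΩ.coeff 0 ∈ E := by
      rw [hmΩ, coeff_map]; exact ((minpoly E x).coeff 0).2
    have h2 : ζ ^ s * x ^ d = (-1) ^ d * mΩ.coeff 0 := by
      rw [hcoeff, ← mul_assoc, ← mul_pow, neg_mul_neg, one_mul, one_pow, one_mul]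
    rw [h2]
    exact mul_mem (pow_mem (neg_mem (one_mem E)) d) h1
  -- hence `ζ^s ∈ K(x)`, so `ζ^s = 1` by (D2)
  have hxd : x ^ d ∈ K⟮x⟯ := pow_mem (mem_adjoin_simple_self K x) d
  have hζs : ζ ^ s ∈ K⟮x⟯ := by
    have h := mul_mem (hE hmemE) (inv_mem hxd)
    rwa [mul_assoc, mul_inv_cancel₀ (pow_ne_zero d hx0), mul_one] at h
  have hζs1 : ζ ^ s = 1 :=
    eq_one_of_pow_eq_one_of_mem hℓ hζK hKx hζs (m := k) (by rw [← pow_mul, mul_comm, pow_mul, hζ.pow_eq_one, one_pow])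
  rw [hζs1, one_mul] at hmemE
  -- and `E = K(x^d)` by degrees
  refine ⟨j, hj, hmemE, ?_, hEj⟩
  have hle : K⟮x ^ d⟯ ≤ E := adjoin_simple_le_iff.mpr hmemE
  have hxdpow : (x ^ d) ^ ℓ ^ j = algebraMap K Ω a := by
    rw [← pow_mul, hd, mul_comm, pow_mul_pow_sub ℓ hj, hx]
  have hfin : finrank K K⟮x ^ d⟯ = finrank K E := by
    rw [finrank_adjoin_eq_prime_pow hℓ hℓ2 ha j hxdpow, hEj]
  exact (eq_of_le_of_finrank_eq hle hfin).symm

/-! ### §4 (D4) The intersection -/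

/-- **Two conjugate radical subfields of a pure Kummer extension of odd prime-power degree
intersect trivially.** Let `ℓ` be an odd prime, `a ∈ K` not an `ℓ`-th power in `K`, `K` without
primitive `ℓ`-th roots of unity, `x ∈ Ω` with `x^{ℓ^k} = a` and `ζ ∈ Ω` a primitive `ℓ^k`-th root
of unity. Then `K(x) ∩ K(ζ x) = K` inside `Ω`. Proof (D4): by (D3) applied to `x` and to `ζ x`
(both roots of `X^{ℓ^k} − a`, both generating degree-`ℓ^k` extensions), `E := K(x) ∩ K(ζx)`
contains `x^d` and `(ζx)^d` for `d = ℓ^k / [E : K]`; so `ζ^d ∈ K(x)`, `ζ^d = 1` by (D2), `ℓ^k ∣ d`,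
`[E : K] = 1`. At `ℓ = 3`, `K = 𝔎` (the completed maximal unramified extension of `ℚ₃` in `ℂ₃`)
this is (K1″) of `cells/x11b3/S28-K1-CHECK.md` §7 (c) — two members of the admissible twist family
already pin the common frame down to `𝔎`. [folklore] -/
theorem adjoin_inf_adjoin_mul_eq_bot {ℓ : ℕ} (hℓ : ℓ.Prime) (hℓ2 : ℓ ≠ 2) {a : K}
    (ha : ∀ b : K, b ^ ℓ ≠ a) (hζK : ∀ z : K, z ^ ℓ = 1 → z = 1) {k : ℕ} {x ζ : Ω}
    (hx : x ^ ℓ ^ k = algebraMap K Ω a) (hζ : IsPrimitiveRoot ζ (ℓ ^ k)) :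
    K⟮x⟯ ⊓ K⟮ζ * x⟯ = ⊥ := by
  have hx0 : x ≠ 0 := root_ne_zero hℓ ha hx
  have hζx : (ζ * x) ^ ℓ ^ k = algebraMap K Ω a := by rw [mul_pow, hζ.pow_eq_one, one_mul, hx]
  have hKx : finrank K K⟮x⟯ = ℓ ^ k := finrank_adjoin_eq_prime_pow hℓ hℓ2 ha k hx
  set E := K⟮x⟯ ⊓ K⟮ζ * x⟯ with hEdef
  obtain ⟨j, hj, hxE, -, hEj⟩ :=
    exists_pow_mem_eq_adjoin_of_le hℓ hℓ2 ha hζK hx hζ (E := E) inf_le_left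
  obtain ⟨j', hj', hζxE, -, hEj'⟩ :=
    exists_pow_mem_eq_adjoin_of_le hℓ hℓ2 ha hζK hζx hζ (E := E) inf_le_right
  have hjj : j' = j := Nat.pow_right_injective hℓ.two_le (hEj'.symm.trans hEj)
  rw [hjj] at hζxE
  set d : ℕ := ℓ ^ (k - j) with hd
  -- `ζ^d ∈ K(x)`
  have hζd : ζ ^ d ∈ K⟮x⟯ := by
    have hxd : x ^ d ∈ K⟮x⟯ := pow_mem (mem_adjoin_simple_self K x) d
    have h := mul_mem (inf_le_left (a := K⟮x⟯) (b := K⟮ζ * x⟯) hζxE) (inv_mem hxd)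
    rwa [mul_pow, mul_assoc, mul_inv_cancel₀ (pow_ne_zero d hx0), mul_one] at h
  have hζd1 : ζ ^ d = 1 :=
    eq_one_of_pow_eq_one_of_mem hℓ hζK hKx hζd (m := k)
      (by rw [← pow_mul, mul_comm, pow_mul, hζ.pow_eq_one, one_pow])
  -- so `ℓ^k ∣ d = ℓ^(k-j)`, forcing `j = 0`
  have hdvd : ℓ ^ k ∣ d := hζ.dvd_of_pow_eq_one d hζd1
  have hj0 : j = 0 := by
    have := Nat.pow_dvd_pow_iff_le_right hℓ.one_lt |>.mp hdvd
    omega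
  rw [hj0, pow_zero, IntermediateField.finrank_eq_one_iff] at hEj
  exact hEj

end Summit.BirchSwinnertonDyer.Rank1Residual.X11b.KummerRadical
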